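import Summits.QuantumFields.YangMills.Theorems.BalabanUVNodesN11NoExpansionGeneralStepCoPH
import Literature.MathematicalPhysics.QuantumFieldTheory.Balaban1983to89.B16RLeafRecord13LiveGenericZS

/-!
# DAG node N11 — THE NO-EXPANSION STEP AFTER AN ARBITRARY HISTORY AT THE v1.7 `CoPH` RECORD, READ THROUGH 𝐑: the level-`k` §2 dichotomy of `ρ_k` at `init s′`
# gives the §2 dichotomy OF `ρ_{k+1}` ITSELF (post-𝐑) at every new sequence `s′` with `Ω_{k+1}(s′) = ∅` — ANY `Ω_1, …, Ω_k` — on the live-selector line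
# (dag-n11-d's 𝐓-side `…NoExpansionGeneralStepCoPH` ∘ this seat's Φ-generic clause-level 𝐑-transfer `…B16RLeafRecord13LiveGenericZS` §0)

Cell `pub-ymgap`, YM-PLAN Track A (HUMAN RULING D-0062), seat `pub-ymgap-dag-n11-e` (g12; R134 fan-out row N11∕s3 «`ThmP245Printed` via `rOperation` from N13's
`ROpLeaf` (pairs with n13-c)»), route `BalabanUVNodes` rev 25 (v1.7 `CoPH` key), item K1⁷ `StabilityBAtRecordR13SepCoPH` = stmt-QuantumFields-20542 (helper lane,
count-neutral).  [III] = [Balaban1988Convergent], [IV] = [Balaban1989LargeFieldI].  The any-history companion of this seat's `…N11DiagonalLevelOneCoPH` §1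
`slotClause_succ_allLarge_CoPH_of_provisos_of_liveSel` (p542814: the same arrow along the ALL-large history) and of the induction `…N11DiagonalInductionCoPH` (p543058).

WHY THIS FILE.  Theorem 1 of [III] (p. 262) is the induction «§2 form of `ρ_k` ⇒ 𝐓-image form of `𝐓ρ_k` (Theorem p. 245) ⇒ §2 form of `ρ_{k+1}` (𝐑, p. 244 ∕ [IV])».
Its step splits over the new sequences `s′` of length `k+1` by whether the new small-field region `Ω_{k+1}(s′)` is empty.  On the branch `Ω_{k+1}(s′) = ∅` (no new expansion;
(3.24)–(3.25): «old factors agree») dag-n11-d's `…NoExpansionGeneralStepCoPH` (p544575) delivers the FIRST arrow AFTER AN ARBITRARY HISTORY `Ω_1, …, Ω_k` at the v1.7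
record: the clause of `SLaw₁₃CoPH θ p k` at `init s′` ⇒ the 𝐓-image clause at `s′` for the history's residual `θ.rzAt p s′` and weights `WtOfRecord₁₃H θ p s′`, same witness
`t`, same constant, under the DISPLAYED data of that file ((P) prefix agreement `hpre`, (V) generation-`k` pin WITH THE OLD FRONT FACTOR `hZ` + `hq`, localities `hloc` ∕
`hqloc` ∕ `hA` (or `hB`), measurability ∕ bound `hm` ∕ `hC` of the no-expansion integrand).  The SECOND arrow at one sequence is this seat's
`slotClauseΦ_succ_of_slotTClauseΦ_of_liveSel_of_rstep` (p539943, §0: arbitrary right-hand side `Φ`, so the history-indexed `sect2Slot … (θ.rzAt p s′) (WtOfRecord₁₃H θ p s′) …`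
is met by `rfl`): on the live-selector line 𝐑 of record moves only dead sequences, so `ρ_{k+1}`'s slot at `s′` inherits the 𝐓-image dichotomy (def-R's row `rstep`,
node00-def-T's selector clause).  HENCE, with no hypothesis on the history below `k+1`:
§1 (generic `θ : Stage13HParams`) `slotClause_succ_CoPH_of_Omega_empty_of_pinChi_of_clause_of_liveSel_of_rstep` (clause-keyed: `hid` at `init s′` ⇒ the post-𝐑 §2 dichotomy
   of `slot_{k+1}(s′)`; rows `rstep` as a hypothesis family, `hloc` displayed) · `…_of_provisos_of_clause_of_liveSel` (keyed on `θ.Provisos₁₃CoPH`: `rstep`, `zhLocal`) · ★★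
   `exists_slotClause_succ_CoPH_of_Omega_empty_of_sLaw₁₃CoPH_of_liveSel` (keyed on `SLaw₁₃CoPH θ p k` ITSELF: THEOREM 1's INDUCTIVE STEP ON THE NO-EXPANSION BRANCH AFTER ANY
   HISTORY, post-𝐑 — there are term values and a constant with the §2 dichotomy of `ρ_{k+1}`'s slot at `s′`; witness `t (init s′)`, `E_{k+1}(s′) = E_k(init s′)`) ·
   `…_of_sLaw₁₃CoPH_of_levelFree_of_liveSel` ((P) AUTOMATIC for a length-free slot value `θ.Zh`, dag-n11-d's `prefix_agree_of_levelFree_of_Omega_empty`) ·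
   `slotClause_succ_CoPH_of_Omega_empty_of_pinChi_of_BLocal_of_clause_of_liveSel` (`hA` from the scale-locality `hB` of the witness's 𝐁-terms).
§2 ★★ `slotClause_succ_theta13LiveOfRecordH_of_Omega_empty_of_pinChi_of_clause` — AT EVERY HISTORY-INDEXED EXTENSION `(⟨⟨theta13LiveOfRecord F N, Zr⟩, Zh, Phih⟩ : Stage13HParams F N)`
   OF THE WITNESS OF RECORD (`Zr`, `Zh`, `Phih` free; node00-def-K0a's cured ∕ history-blind members are such extensions by `rfl`): row `rstep` and the selector clause are
   K0a ∕ K0b ∕ def-R THEOREMS there (`slotClauseΦ_succ_of_slotTClauseΦ_theta13LiveOfRecord`, zero hypotheses beyond `k < K`), `M = 1` by the family's numerals — only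
   dag-n11-d's displayed 𝐓-side data remain.

HONEST FRAMING.  Count-neutral kernel bookkeeping — two seats' tree theorems composed by name, ONE application each; it covers the ONE no-expansion new step per old history
(the sequences with `Ω_{k+1}(s′) ≠ ∅` are [III] Sect. 1 ∕ §3 ∕ Thm 2 proper — the load-bearing content of (S1ᵀ), NOT here); CLAUSE level (the law package `LawsRT … (k+1)` of
the carried witness at `s′` is not asserted here); the dichotomy's zero branch is NOT excluded; the (P)∕(V)∕locality∕measurability binders are DISPLAYED exactly as in p544575
(whether print's R-rewritten `ζ` of [IV] meets (V) off the history-blind door is [IV]'s body, unread — director-ym №186; a VALUE of `θ.Zh` is node00-def-K0a∕K0b's lane);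
nothing of Bałaban asserted; N11 NOT discharged; K1⁷ NOT closed; counts unmoved (typed 28∕28 · discharged 5∕27).  One finite `𝕋⁴_{L^K}` programme at fixed `ε = L^{−K}`;
NOT ℝ⁴, NOT OS, NOT a mass gap, NOT Clay.
Sources: [III] Thm 1 p.262, Theorem p.245, (2.17)–(2.18) p.257, (2.20)–(2.25) pp.258–259, (2.40) p.261, (3.16) p.268, (3.21) p.269, (3.24)–(3.25) p.270, (1.11) p.248;
[IV] (0.2)–(0.4) p.176, p.177 (i)–(ii).
-/

noncomputable section

open MeasureTheory
open scoped BigOperators Matrix.Norms.L2Operator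

namespace Summit.QuantumFields.YangMills.Theorems.BalabanUVNodesN11NoExpansionGeneralStepPostRCoPH

open Literature.MathematicalPhysics.QuantumFieldTheory.Balaban1983to89 T4Continuum Node00 Node00.Tk DagBinding
open Literature.MathematicalPhysics.QuantumFieldTheory.Balaban1983to89.B16RLeafRecord13LiveGenericZS
open BalabanUVNodesN11NoExpansionGeneralStepCoPH (clause_succ_CoPH_of_Omega_empty_of_pinChi_of_clause
  clause_succ_CoPH_of_Omega_empty_of_pinChi_of_provisos_of_clause exists_clause_succ_CoPH_of_Omega_empty_of_sLaw₁₃CoPH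
  clause_succ_CoPH_of_Omega_empty_of_pinChi_of_BLocal_of_clause prefix_agree_of_levelFree_of_Omega_empty)

variable {F : T4Family} {N : ℕ} [NeZero N]

/-! ## §1. Generic `θ : Stage13HParams` on the live-selector line — the post-𝐑 clause at a no-expansion new step after ANY history -/

section Generic

variable (θ : Stage13HParams F N) (p : B12.RunParams)

/-- **THE NO-EXPANSION STEP AFTER AN ARBITRARY HISTORY, READ THROUGH 𝐑 — clause-keyed, generic `θ : Stage13HParams`.**  From def-R's row `rstep` (as a hypothesis family at
`θ.toStage13Params`), node00-def-T's live-selector clause, `k < K`, `1 ≤ M`, a new sequence `s′` of length `k+1` with `Ω_{k+1}(s′) = ∅` (ANY `Ω_1, …, Ω_k`), and dag-n11-d's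
displayed data of `clause_succ_CoPH_of_Omega_empty_of_pinChi_of_clause` VERBATIM (`hloc`, `hqloc`, (P) `hpre`, the witness `(t, E₀)`, `hA`, the level-`k` clause `hid` at
`init s′`, (V) `hZ` + `hq`, `hm` ∕ `hC`): the post-𝐑 slot of `ρ_{k+1}` at `s′` is absent, or equals `𝐓_{k+1}(s′)[WtOfRecord₁₃H θ p s′] exp A_{k+1}(s′)[θ.rzAt p s′]` at `(t, E₀)`
`dV_{k+1}`-a.e. on `supp χ_{k+1}(s′)`.  Proof: dag-n11-d's 𝐓-side clause at `s′`, then this seat's `slotClauseΦ_succ_of_slotTClauseΦ_of_liveSel_of_rstep` (the 𝐓-clause is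
used whether or not `s′` is live). [cite: Balaban1988Convergent, Thm 1 p.262, Theorem p.245, (3.24)–(3.25) p.270, (2.18) p.257, (2.20)–(2.25) pp.258–259, (3.16) p.268; Balaban1989LargeFieldI, (0.2)–(0.4) p.176, p.177 (i)–(ii)] -/
theorem slotClause_succ_CoPH_of_Omega_empty_of_pinChi_of_clause_of_liveSel_of_rstep
    (hrstep : ∀ (q : B12.RunParams) (j : ℕ) [DecidableEq (PBond (F.P q.K) (j + 1))], j < q.K →
      (towerRepOfRecord F N θ.ν θ.τ9 (slotsTOfRecord F N θ.ν θ.τ9 (EOfRecord₁₃ F N θ.toStage13Params) (wOfRecord₉ F N θ.toStage9Params) θ.ppSel)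
        θ.ppSel q (gOfRecord₁₃ F N θ.toStage13Params q) (j + 1)).toRepData.ProvisosInt)
    (hsel : θ.ppSel = ppSelLiveOfRecord F N θ.ν θ.τ9 (EOfRecord₁₃ F N θ.toStage13Params) (wOfRecord₉ F N θ.toStage9Params))
    {k : ℕ} (hk : k < p.K) (hM : 1 ≤ θ.τ9.M)
    (s : SeqOfRecord F θ.ν θ.τ9.M (gOfRecord₁₃ F N θ.toStage13Params p) p.K (k + 1)) (hΩ : s.Ω (k + 1) = ∅)
    (hloc : (θ.zhAt p s).LocalLaws)
    (hqloc : ∀ j, j < k → ∀ ω ω' : MultiCfg (F.P p.K) (SU N) (FluctV N), (∀ i, i ≤ k → ω i = ω' i) →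
      (θ.zhAt p s).quad j (s.init.Λ (j + 1)) ω = (θ.zhAt p s).quad j (s.init.Λ (j + 1)) ω')
    (hpre : ∀ j, j < k → (θ.zhAt p s).ζ0 j = (θ.zhAt p s.init).ζ0 j ∧ (θ.zhAt p s).quad j = (θ.zhAt p s.init).quad j)
    (t : Sect2.TermValues (F.P p.K) (MatA N) (FluctV N) θ.τ9.M) (E₀ : ℝ)
    (hA : ∀ (S : ℕ → Set (Site (F.P p.K) 0)) (a a' : Tk.MSFluct (F.P p.K) (FluctV N)) (Uf : GaugeField (F.P p.K) 0 (SU N)), (∀ i, i ≤ k → a i = a' i) →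
      (sect2ActionDataOfRecord F N (FluctV N) p.K (settingOfRecord₁₃ F N θ.toStage13Params p) (θ.rzAt p s.init) s.init t (S, a) E₀).action23 k Uf =
        (sect2ActionDataOfRecord F N (FluctV N) p.K (settingOfRecord₁₃ F N θ.toStage13Params p) (θ.rzAt p s.init) s.init t (S, a') E₀).action23 k Uf)
    (hid : slotsOfRecord F N θ.ν θ.τ9 (EOfRecord₁₃ F N θ.toStage13Params) (wOfRecord₉ F N θ.toStage9Params) θ.ppSel p
        (gOfRecord₁₃ F N θ.toStage13Params p) k s.init = 0 ∨
      ∀ᵐ U₀ ∂fieldMeasure (F.P p.K) k (SU N),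
        chiSeqOfRecord F N θ.ν θ.τ9.M (gOfRecord₁₃ F N θ.toStage13Params p) p.K k s.init U₀ ≠ 0 →
          slotsOfRecord F N θ.ν θ.τ9 (EOfRecord₁₃ F N θ.toStage13Params) (wOfRecord₉ F N θ.toStage9Params) θ.ppSel p
              (gOfRecord₁₃ F N θ.toStage13Params p) k s.init U₀ =
            sect2Slot F N (FluctV N) p.K (settingOfRecord₁₃ F N θ.toStage13Params p) (θ.rzAt p s.init) (WtOfRecord₁₃H F N θ p s.init) s.init t E₀
              (UbgOfRecord₁₃CoP F N θ.toStage13Params p k s.init) U₀)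
    (hZ : ∀ (V' : GaugeField (F.P p.K) (k + 1) (SU N)) (U₀ : GaugeField (F.P p.K) k (SU N)),
      (θ.zhAt p s).ζ0 k Set.univ (pairCfgAt (V := FluctV N) k V' U₀) =
        chiSeqOfRecord F N θ.ν θ.τ9.M (gOfRecord₁₃ F N θ.toStage13Params p) p.K k s.init U₀ *
          wOfRecord₉ F N θ.toStage9Params p (gOfRecord₁₃ F N θ.toStage13Params p) k s U₀ ((avOfRecord F N p.K k).avg U₀))
    (hq : ∀ (V' : GaugeField (F.P p.K) (k + 1) (SU N)) (U₀ : GaugeField (F.P p.K) k (SU N)), (θ.zhAt p s).quad k ∅ (pairCfgAt (V := FluctV N) k V' U₀) = 0)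
    {C : ℝ}
    (hm : ∀ S ∈ admSOfRecord F θ.ν θ.τ9.M (gOfRecord₁₃ F N θ.toStage13Params p) p.K k s.init,
      Measurable (Function.uncurry (noExpIntegrandAt F N (FluctV N) p.K k (WtOfRecord₁₃H F N θ p s)
        (tkBranchOfRecord F N (FluctV N) θ.ν θ.τ9.M _ p.K (WtOfRecord₁₃H F N θ p s) s.init S k
          (fun ω => sect2Operand F N (FluctV N) p.K (settingOfRecord₁₃ F N θ.toStage13Params p) (θ.rzAt p s) s t E₀
            (UbgOfRecord₁₃CoP F N θ.toStage13Params p (k + 1) s) (S, fun j => (ω j).2) (fun j => (ω j).1))))))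
    (hC : ∀ S ∈ admSOfRecord F θ.ν θ.τ9.M (gOfRecord₁₃ F N θ.toStage13Params p) p.K k s.init, ∀ V' U₀,
      |noExpIntegrandAt F N (FluctV N) p.K k (WtOfRecord₁₃H F N θ p s)
        (tkBranchOfRecord F N (FluctV N) θ.ν θ.τ9.M _ p.K (WtOfRecord₁₃H F N θ p s) s.init S k
          (fun ω => sect2Operand F N (FluctV N) p.K (settingOfRecord₁₃ F N θ.toStage13Params p) (θ.rzAt p s) s t E₀
            (UbgOfRecord₁₃CoP F N θ.toStage13Params p (k + 1) s) (S, fun j => (ω j).2) (fun j => (ω j).1)))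
        V' U₀| ≤ C) :
    slotsOfRecord F N θ.ν θ.τ9 (EOfRecord₁₃ F N θ.toStage13Params) (wOfRecord₉ F N θ.toStage9Params) θ.ppSel p
        (gOfRecord₁₃ F N θ.toStage13Params p) (k + 1) s = 0 ∨
      ∀ᵐ V' ∂fieldMeasure (F.P p.K) (k + 1) (SU N),
        chiSeqOfRecord F N θ.ν θ.τ9.M (gOfRecord₁₃ F N θ.toStage13Params p) p.K (k + 1) s V' ≠ 0 →
          slotsOfRecord F N θ.ν θ.τ9 (EOfRecord₁₃ F N θ.toStage13Params) (wOfRecord₉ F N θ.toStage9Params) θ.ppSel p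
              (gOfRecord₁₃ F N θ.toStage13Params p) (k + 1) s V' =
            sect2Slot F N (FluctV N) p.K (settingOfRecord₁₃ F N θ.toStage13Params p) (θ.rzAt p s) (WtOfRecord₁₃H F N θ p s) s t E₀
              (UbgOfRecord₁₃CoP F N θ.toStage13Params p (k + 1) s) V' :=
  -- 𝐓-side: dag-n11-d's clause-keyed step at `s′` after any history; 𝐑-side: this seat's Φ-generic transfer at one sequence on the live-selector line
  slotClauseΦ_succ_of_slotTClauseΦ_of_liveSel_of_rstep F N θ.toStage13Params p hrstep hsel k hk s _ fun _ =>
    clause_succ_CoPH_of_Omega_empty_of_pinChi_of_clause θ p hk hM s hΩ hloc hqloc hpre t E₀ hA hid hZ hq hm hC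

/-- **… keyed on node00-def-T's v1.7 core provisos `θ.Provisos₁₃CoPH`** (rows `rstep` — the 𝐑-side — and `zhLocal` — dag-n11-d's `hloc`); the selector clause, the
witness `(t, E₀)`, the level-`k` clause `hid` at `init s′` and the (P)∕(V)∕locality∕measurability data displayed. [cite: Balaban1988Convergent, Thm 1 p.262, Theorem p.245, (3.24)–(3.25) p.270, (3.2)–(3.9) pp.265–266, (2.20)–(2.25) pp.258–259; Balaban1989LargeFieldI, (0.3)–(0.4) p.176, p.177 (i)–(ii)] -/
theorem slotClause_succ_CoPH_of_Omega_empty_of_pinChi_of_provisos_of_clause_of_liveSel (h : θ.Provisos₁₃CoPH F N)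
    (hsel : θ.ppSel = ppSelLiveOfRecord F N θ.ν θ.τ9 (EOfRecord₁₃ F N θ.toStage13Params) (wOfRecord₉ F N θ.toStage9Params))
    {k : ℕ} (hk : k < p.K) (hM : 1 ≤ θ.τ9.M)
    (s : SeqOfRecord F θ.ν θ.τ9.M (gOfRecord₁₃ F N θ.toStage13Params p) p.K (k + 1)) (hΩ : s.Ω (k + 1) = ∅)
    (hqloc : ∀ j, j < k → ∀ ω ω' : MultiCfg (F.P p.K) (SU N) (FluctV N), (∀ i, i ≤ k → ω i = ω' i) →
      (θ.zhAt p s).quad j (s.init.Λ (j + 1)) ω = (θ.zhAt p s).quad j (s.init.Λ (j + 1)) ω')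
    (hpre : ∀ j, j < k → (θ.zhAt p s).ζ0 j = (θ.zhAt p s.init).ζ0 j ∧ (θ.zhAt p s).quad j = (θ.zhAt p s.init).quad j)
    (t : Sect2.TermValues (F.P p.K) (MatA N) (FluctV N) θ.τ9.M) (E₀ : ℝ)
    (hA : ∀ (S : ℕ → Set (Site (F.P p.K) 0)) (a a' : Tk.MSFluct (F.P p.K) (FluctV N)) (Uf : GaugeField (F.P p.K) 0 (SU N)), (∀ i, i ≤ k → a i = a' i) →
      (sect2ActionDataOfRecord F N (FluctV N) p.K (settingOfRecord₁₃ F N θ.toStage13Params p) (θ.rzAt p s.init) s.init t (S, a) E₀).action23 k Uf =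
        (sect2ActionDataOfRecord F N (FluctV N) p.K (settingOfRecord₁₃ F N θ.toStage13Params p) (θ.rzAt p s.init) s.init t (S, a') E₀).action23 k Uf)
    (hid : slotsOfRecord F N θ.ν θ.τ9 (EOfRecord₁₃ F N θ.toStage13Params) (wOfRecord₉ F N θ.toStage9Params) θ.ppSel p
        (gOfRecord₁₃ F N θ.toStage13Params p) k s.init = 0 ∨
      ∀ᵐ U₀ ∂fieldMeasure (F.P p.K) k (SU N),
        chiSeqOfRecord F N θ.ν θ.τ9.M (gOfRecord₁₃ F N θ.toStage13Params p) p.K k s.init U₀ ≠ 0 →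
          slotsOfRecord F N θ.ν θ.τ9 (EOfRecord₁₃ F N θ.toStage13Params) (wOfRecord₉ F N θ.toStage9Params) θ.ppSel p
              (gOfRecord₁₃ F N θ.toStage13Params p) k s.init U₀ =
            sect2Slot F N (FluctV N) p.K (settingOfRecord₁₃ F N θ.toStage13Params p) (θ.rzAt p s.init) (WtOfRecord₁₃H F N θ p s.init) s.init t E₀
              (UbgOfRecord₁₃CoP F N θ.toStage13Params p k s.init) U₀)
    (hZ : ∀ (V' : GaugeField (F.P p.K) (k + 1) (SU N)) (U₀ : GaugeField (F.P p.K) k (SU N)),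
      (θ.zhAt p s).ζ0 k Set.univ (pairCfgAt (V := FluctV N) k V' U₀) =
        chiSeqOfRecord F N θ.ν θ.τ9.M (gOfRecord₁₃ F N θ.toStage13Params p) p.K k s.init U₀ *
          wOfRecord₉ F N θ.toStage9Params p (gOfRecord₁₃ F N θ.toStage13Params p) k s U₀ ((avOfRecord F N p.K k).avg U₀))
    (hq : ∀ (V' : GaugeField (F.P p.K) (k + 1) (SU N)) (U₀ : GaugeField (F.P p.K) k (SU N)), (θ.zhAt p s).quad k ∅ (pairCfgAt (V := FluctV N) k V' U₀) = 0)
    {C : ℝ}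
    (hm : ∀ S ∈ admSOfRecord F θ.ν θ.τ9.M (gOfRecord₁₃ F N θ.toStage13Params p) p.K k s.init,
      Measurable (Function.uncurry (noExpIntegrandAt F N (FluctV N) p.K k (WtOfRecord₁₃H F N θ p s)
        (tkBranchOfRecord F N (FluctV N) θ.ν θ.τ9.M _ p.K (WtOfRecord₁₃H F N θ p s) s.init S k
          (fun ω => sect2Operand F N (FluctV N) p.K (settingOfRecord₁₃ F N θ.toStage13Params p) (θ.rzAt p s) s t E₀
            (UbgOfRecord₁₃CoP F N θ.toStage13Params p (k + 1) s) (S, fun j => (ω j).2) (fun j => (ω j).1))))))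
    (hC : ∀ S ∈ admSOfRecord F θ.ν θ.τ9.M (gOfRecord₁₃ F N θ.toStage13Params p) p.K k s.init, ∀ V' U₀,
      |noExpIntegrandAt F N (FluctV N) p.K k (WtOfRecord₁₃H F N θ p s)
        (tkBranchOfRecord F N (FluctV N) θ.ν θ.τ9.M _ p.K (WtOfRecord₁₃H F N θ p s) s.init S k
          (fun ω => sect2Operand F N (FluctV N) p.K (settingOfRecord₁₃ F N θ.toStage13Params p) (θ.rzAt p s) s t E₀
            (UbgOfRecord₁₃CoP F N θ.toStage13Params p (k + 1) s) (S, fun j => (ω j).2) (fun j => (ω j).1)))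
        V' U₀| ≤ C) :
    slotsOfRecord F N θ.ν θ.τ9 (EOfRecord₁₃ F N θ.toStage13Params) (wOfRecord₉ F N θ.toStage9Params) θ.ppSel p
        (gOfRecord₁₃ F N θ.toStage13Params p) (k + 1) s = 0 ∨
      ∀ᵐ V' ∂fieldMeasure (F.P p.K) (k + 1) (SU N),
        chiSeqOfRecord F N θ.ν θ.τ9.M (gOfRecord₁₃ F N θ.toStage13Params p) p.K (k + 1) s V' ≠ 0 →
          slotsOfRecord F N θ.ν θ.τ9 (EOfRecord₁₃ F N θ.toStage13Params) (wOfRecord₉ F N θ.toStage9Params) θ.ppSel p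
              (gOfRecord₁₃ F N θ.toStage13Params p) (k + 1) s V' =
            sect2Slot F N (FluctV N) p.K (settingOfRecord₁₃ F N θ.toStage13Params p) (θ.rzAt p s) (WtOfRecord₁₃H F N θ p s) s t E₀
              (UbgOfRecord₁₃CoP F N θ.toStage13Params p (k + 1) s) V' :=
  slotClauseΦ_succ_of_slotTClauseΦ_of_liveSel_of_rstep F N θ.toStage13Params p (fun q j _ hj => h.rstep q j hj) hsel k hk s _ fun _ =>
    clause_succ_CoPH_of_Omega_empty_of_pinChi_of_provisos_of_clause θ p h hk hM s hΩ hqloc hpre t E₀ hA hid hZ hq hm hC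

/-- **★★ THEOREM 1's INDUCTIVE STEP ON THE NO-EXPANSION BRANCH AFTER ANY HISTORY, READ THROUGH 𝐑 — keyed on `SLaw₁₃CoPH θ p k` ITSELF.**  From the §2 form of `ρ_k` at the
v1.7 record, the core provisos, the live-selector clause, `k < K`, `1 ≤ M`, and — at a new sequence `s′` with `Ω_{k+1}(s′) = ∅` after ANY history — dag-n11-d's displayed
(P)∕(V)∕locality data on the history's residual `θ.zhAt p s′` and the displayed `hA` ∕ `hm` ∕ `hC` for every `(t₀, E₀)`: THERE ARE term values and a constant with the §2
dichotomy of `ρ_{k+1}`'s post-𝐑 slot at `s′` at the history's residual `θ.rzAt p s′`, weights `WtOfRecord₁₃H θ p s′` and def-R's background — witness `t (init s′)`,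
`E_{k+1}(s′) = E_k(init s′)` (dag-n11-d's `exists_clause_succ_CoPH_of_Omega_empty_of_sLaw₁₃CoPH`, then this seat's 𝐑-transfer). [cite: Balaban1988Convergent, Thm 1 p.262, Theorem p.245, (3.24)–(3.25) p.270, (2.17)–(2.18) p.257, (2.20)–(2.25) pp.258–259, (1.11) p.248; Balaban1989LargeFieldI, (0.2)–(0.4) p.176, p.177 (i)–(ii)] -/
theorem exists_slotClause_succ_CoPH_of_Omega_empty_of_sLaw₁₃CoPH_of_liveSel (h : θ.Provisos₁₃CoPH F N)
    (hsel : θ.ppSel = ppSelLiveOfRecord F N θ.ν θ.τ9 (EOfRecord₁₃ F N θ.toStage13Params) (wOfRecord₉ F N θ.toStage9Params))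
    {k : ℕ} (hk : k < p.K) (hM : 1 ≤ θ.τ9.M) (hS : SLaw₁₃CoPH F N θ p k)
    (s : SeqOfRecord F θ.ν θ.τ9.M (gOfRecord₁₃ F N θ.toStage13Params p) p.K (k + 1)) (hΩ : s.Ω (k + 1) = ∅)
    (hqloc : ∀ j, j < k → ∀ ω ω' : MultiCfg (F.P p.K) (SU N) (FluctV N), (∀ i, i ≤ k → ω i = ω' i) →
      (θ.zhAt p s).quad j (s.init.Λ (j + 1)) ω = (θ.zhAt p s).quad j (s.init.Λ (j + 1)) ω')
    (hpre : ∀ j, j < k → (θ.zhAt p s).ζ0 j = (θ.zhAt p s.init).ζ0 j ∧ (θ.zhAt p s).quad j = (θ.zhAt p s.init).quad j)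
    (hA : ∀ (t₀ : Sect2.TermValues (F.P p.K) (MatA N) (FluctV N) θ.τ9.M) (E₀ : ℝ) (S : ℕ → Set (Site (F.P p.K) 0))
      (a a' : Tk.MSFluct (F.P p.K) (FluctV N)) (Uf : GaugeField (F.P p.K) 0 (SU N)), (∀ i, i ≤ k → a i = a' i) →
      (sect2ActionDataOfRecord F N (FluctV N) p.K (settingOfRecord₁₃ F N θ.toStage13Params p) (θ.rzAt p s.init) s.init t₀ (S, a) E₀).action23 k Uf =
        (sect2ActionDataOfRecord F N (FluctV N) p.K (settingOfRecord₁₃ F N θ.toStage13Params p) (θ.rzAt p s.init) s.init t₀ (S, a') E₀).action23 k Uf)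
    (hZ : ∀ (V' : GaugeField (F.P p.K) (k + 1) (SU N)) (U₀ : GaugeField (F.P p.K) k (SU N)),
      (θ.zhAt p s).ζ0 k Set.univ (pairCfgAt (V := FluctV N) k V' U₀) =
        chiSeqOfRecord F N θ.ν θ.τ9.M (gOfRecord₁₃ F N θ.toStage13Params p) p.K k s.init U₀ *
          wOfRecord₉ F N θ.toStage9Params p (gOfRecord₁₃ F N θ.toStage13Params p) k s U₀ ((avOfRecord F N p.K k).avg U₀))
    (hq : ∀ (V' : GaugeField (F.P p.K) (k + 1) (SU N)) (U₀ : GaugeField (F.P p.K) k (SU N)), (θ.zhAt p s).quad k ∅ (pairCfgAt (V := FluctV N) k V' U₀) = 0)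
    {C : ℝ}
    (hm : ∀ (t₀ : Sect2.TermValues (F.P p.K) (MatA N) (FluctV N) θ.τ9.M) (E₀ : ℝ),
      ∀ S ∈ admSOfRecord F θ.ν θ.τ9.M (gOfRecord₁₃ F N θ.toStage13Params p) p.K k s.init,
      Measurable (Function.uncurry (noExpIntegrandAt F N (FluctV N) p.K k (WtOfRecord₁₃H F N θ p s)
        (tkBranchOfRecord F N (FluctV N) θ.ν θ.τ9.M _ p.K (WtOfRecord₁₃H F N θ p s) s.init S k
          (fun ω => sect2Operand F N (FluctV N) p.K (settingOfRecord₁₃ F N θ.toStage13Params p) (θ.rzAt p s) s t₀ E₀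
            (UbgOfRecord₁₃CoP F N θ.toStage13Params p (k + 1) s) (S, fun j => (ω j).2) (fun j => (ω j).1))))))
    (hC : ∀ (t₀ : Sect2.TermValues (F.P p.K) (MatA N) (FluctV N) θ.τ9.M) (E₀ : ℝ),
      ∀ S ∈ admSOfRecord F θ.ν θ.τ9.M (gOfRecord₁₃ F N θ.toStage13Params p) p.K k s.init, ∀ V' U₀,
      |noExpIntegrandAt F N (FluctV N) p.K k (WtOfRecord₁₃H F N θ p s)
        (tkBranchOfRecord F N (FluctV N) θ.ν θ.τ9.M _ p.K (WtOfRecord₁₃H F N θ p s) s.init S k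
          (fun ω => sect2Operand F N (FluctV N) p.K (settingOfRecord₁₃ F N θ.toStage13Params p) (θ.rzAt p s) s t₀ E₀
            (UbgOfRecord₁₃CoP F N θ.toStage13Params p (k + 1) s) (S, fun j => (ω j).2) (fun j => (ω j).1)))
        V' U₀| ≤ C) :
    ∃ (t₀ : Sect2.TermValues (F.P p.K) (MatA N) (FluctV N) θ.τ9.M) (E' : ℝ),
      slotsOfRecord F N θ.ν θ.τ9 (EOfRecord₁₃ F N θ.toStage13Params) (wOfRecord₉ F N θ.toStage9Params) θ.ppSel p
          (gOfRecord₁₃ F N θ.toStage13Params p) (k + 1) s = 0 ∨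
        ∀ᵐ V' ∂fieldMeasure (F.P p.K) (k + 1) (SU N),
          chiSeqOfRecord F N θ.ν θ.τ9.M (gOfRecord₁₃ F N θ.toStage13Params p) p.K (k + 1) s V' ≠ 0 →
            slotsOfRecord F N θ.ν θ.τ9 (EOfRecord₁₃ F N θ.toStage13Params) (wOfRecord₉ F N θ.toStage9Params) θ.ppSel p
                (gOfRecord₁₃ F N θ.toStage13Params p) (k + 1) s V' =
              sect2Slot F N (FluctV N) p.K (settingOfRecord₁₃ F N θ.toStage13Params p) (θ.rzAt p s) (WtOfRecord₁₃H F N θ p s) s t₀ E'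
                (UbgOfRecord₁₃CoP F N θ.toStage13Params p (k + 1) s) V' := by
  obtain ⟨t₀, E', hT⟩ := exists_clause_succ_CoPH_of_Omega_empty_of_sLaw₁₃CoPH θ p h hk hM hS s hΩ hqloc hpre hA hZ hq hm hC
  exact ⟨t₀, E', slotClauseΦ_succ_of_slotTClauseΦ_of_liveSel_of_rstep F N θ.toStage13Params p (fun q j _ hj => h.rstep q j hj) hsel k hk s _ fun _ => hT⟩

/-- **… with (P) AUTOMATIC for a LENGTH-FREE slot value** (`θ.Zh p n Ω Λ` does not read `n`; dag-n11-d's `prefix_agree_of_levelFree_of_Omega_empty`: at a no-expansion step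
`init s′` and `s′` have the same region FUNCTIONS, so the residual serving `s′` IS the one serving `init s′`). [cite: Balaban1988Convergent, Thm 1 p.262, Theorem p.245, (3.24)–(3.25) p.270, (2.1) p.254, p.257, (2.20)–(2.22) p.258; Balaban1989LargeFieldI, (0.2)–(0.4) p.176, p.177 (i)–(ii)] -/
theorem exists_slotClause_succ_CoPH_of_Omega_empty_of_sLaw₁₃CoPH_of_levelFree_of_liveSel (h : θ.Provisos₁₃CoPH F N)
    (hsel : θ.ppSel = ppSelLiveOfRecord F N θ.ν θ.τ9 (EOfRecord₁₃ F N θ.toStage13Params) (wOfRecord₉ F N θ.toStage9Params))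
    (hZh : ∀ (n n' : ℕ) (Ω Λ : ℕ → Set (Site (F.P p.K) 0)), θ.Zh p n Ω Λ = θ.Zh p n' Ω Λ)
    {k : ℕ} (hk : k < p.K) (hM : 1 ≤ θ.τ9.M) (hS : SLaw₁₃CoPH F N θ p k)
    (s : SeqOfRecord F θ.ν θ.τ9.M (gOfRecord₁₃ F N θ.toStage13Params p) p.K (k + 1)) (hΩ : s.Ω (k + 1) = ∅)
    (hqloc : ∀ j, j < k → ∀ ω ω' : MultiCfg (F.P p.K) (SU N) (FluctV N), (∀ i, i ≤ k → ω i = ω' i) →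
      (θ.zhAt p s).quad j (s.init.Λ (j + 1)) ω = (θ.zhAt p s).quad j (s.init.Λ (j + 1)) ω')
    (hA : ∀ (t₀ : Sect2.TermValues (F.P p.K) (MatA N) (FluctV N) θ.τ9.M) (E₀ : ℝ) (S : ℕ → Set (Site (F.P p.K) 0))
      (a a' : Tk.MSFluct (F.P p.K) (FluctV N)) (Uf : GaugeField (F.P p.K) 0 (SU N)), (∀ i, i ≤ k → a i = a' i) →
      (sect2ActionDataOfRecord F N (FluctV N) p.K (settingOfRecord₁₃ F N θ.toStage13Params p) (θ.rzAt p s.init) s.init t₀ (S, a) E₀).action23 k Uf =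
        (sect2ActionDataOfRecord F N (FluctV N) p.K (settingOfRecord₁₃ F N θ.toStage13Params p) (θ.rzAt p s.init) s.init t₀ (S, a') E₀).action23 k Uf)
    (hZ : ∀ (V' : GaugeField (F.P p.K) (k + 1) (SU N)) (U₀ : GaugeField (F.P p.K) k (SU N)),
      (θ.zhAt p s).ζ0 k Set.univ (pairCfgAt (V := FluctV N) k V' U₀) =
        chiSeqOfRecord F N θ.ν θ.τ9.M (gOfRecord₁₃ F N θ.toStage13Params p) p.K k s.init U₀ *
          wOfRecord₉ F N θ.toStage9Params p (gOfRecord₁₃ F N θ.toStage13Params p) k s U₀ ((avOfRecord F N p.K k).avg U₀))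
    (hq : ∀ (V' : GaugeField (F.P p.K) (k + 1) (SU N)) (U₀ : GaugeField (F.P p.K) k (SU N)), (θ.zhAt p s).quad k ∅ (pairCfgAt (V := FluctV N) k V' U₀) = 0)
    {C : ℝ}
    (hm : ∀ (t₀ : Sect2.TermValues (F.P p.K) (MatA N) (FluctV N) θ.τ9.M) (E₀ : ℝ),
      ∀ S ∈ admSOfRecord F θ.ν θ.τ9.M (gOfRecord₁₃ F N θ.toStage13Params p) p.K k s.init,
      Measurable (Function.uncurry (noExpIntegrandAt F N (FluctV N) p.K k (WtOfRecord₁₃H F N θ p s)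
        (tkBranchOfRecord F N (FluctV N) θ.ν θ.τ9.M _ p.K (WtOfRecord₁₃H F N θ p s) s.init S k
          (fun ω => sect2Operand F N (FluctV N) p.K (settingOfRecord₁₃ F N θ.toStage13Params p) (θ.rzAt p s) s t₀ E₀
            (UbgOfRecord₁₃CoP F N θ.toStage13Params p (k + 1) s) (S, fun j => (ω j).2) (fun j => (ω j).1))))))
    (hC : ∀ (t₀ : Sect2.TermValues (F.P p.K) (MatA N) (FluctV N) θ.τ9.M) (E₀ : ℝ),
      ∀ S ∈ admSOfRecord F θ.ν θ.τ9.M (gOfRecord₁₃ F N θ.toStage13Params p) p.K k s.init, ∀ V' U₀,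
      |noExpIntegrandAt F N (FluctV N) p.K k (WtOfRecord₁₃H F N θ p s)
        (tkBranchOfRecord F N (FluctV N) θ.ν θ.τ9.M _ p.K (WtOfRecord₁₃H F N θ p s) s.init S k
          (fun ω => sect2Operand F N (FluctV N) p.K (settingOfRecord₁₃ F N θ.toStage13Params p) (θ.rzAt p s) s t₀ E₀
            (UbgOfRecord₁₃CoP F N θ.toStage13Params p (k + 1) s) (S, fun j => (ω j).2) (fun j => (ω j).1)))
        V' U₀| ≤ C) :
    ∃ (t₀ : Sect2.TermValues (F.P p.K) (MatA N) (FluctV N) θ.τ9.M) (E' : ℝ),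
      slotsOfRecord F N θ.ν θ.τ9 (EOfRecord₁₃ F N θ.toStage13Params) (wOfRecord₉ F N θ.toStage9Params) θ.ppSel p
          (gOfRecord₁₃ F N θ.toStage13Params p) (k + 1) s = 0 ∨
        ∀ᵐ V' ∂fieldMeasure (F.P p.K) (k + 1) (SU N),
          chiSeqOfRecord F N θ.ν θ.τ9.M (gOfRecord₁₃ F N θ.toStage13Params p) p.K (k + 1) s V' ≠ 0 →
            slotsOfRecord F N θ.ν θ.τ9 (EOfRecord₁₃ F N θ.toStage13Params) (wOfRecord₉ F N θ.toStage9Params) θ.ppSel p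
                (gOfRecord₁₃ F N θ.toStage13Params p) (k + 1) s V' =
              sect2Slot F N (FluctV N) p.K (settingOfRecord₁₃ F N θ.toStage13Params p) (θ.rzAt p s) (WtOfRecord₁₃H F N θ p s) s t₀ E'
                (UbgOfRecord₁₃CoP F N θ.toStage13Params p (k + 1) s) V' :=
  exists_slotClause_succ_CoPH_of_Omega_empty_of_sLaw₁₃CoPH_of_liveSel θ p h hsel hk hM hS s hΩ hqloc
    (prefix_agree_of_levelFree_of_Omega_empty θ p hZh s hΩ) hA hZ hq hm hC

/-- **… clause-keyed, with `hA` DISCHARGED FROM THE SCALE-LOCALITY `hB` OF THE WITNESS's 𝐁-TERMS** (dag-n11-d's `clause_succ_CoPH_of_Omega_empty_of_pinChi_of_BLocal_of_clause`,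
keyed on `θ.Provisos₁₃CoPH`), read through 𝐑 on the live-selector line. [cite: Balaban1988Convergent, Thm 1 p.262, Theorem p.245, (2.40)–(2.41) p.261, (3.24)–(3.25) p.270; Balaban1989LargeFieldI, (0.3)–(0.4) p.176, p.177 (i)–(ii)] -/
theorem slotClause_succ_CoPH_of_Omega_empty_of_pinChi_of_BLocal_of_clause_of_liveSel (h : θ.Provisos₁₃CoPH F N)
    (hsel : θ.ppSel = ppSelLiveOfRecord F N θ.ν θ.τ9 (EOfRecord₁₃ F N θ.toStage13Params) (wOfRecord₉ F N θ.toStage9Params))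
    {k : ℕ} (hk : k < p.K) (hM : 1 ≤ θ.τ9.M)
    (s : SeqOfRecord F θ.ν θ.τ9.M (gOfRecord₁₃ F N θ.toStage13Params p) p.K (k + 1)) (hΩ : s.Ω (k + 1) = ∅)
    (hqloc : ∀ j, j < k → ∀ ω ω' : MultiCfg (F.P p.K) (SU N) (FluctV N), (∀ i, i ≤ k → ω i = ω' i) →
      (θ.zhAt p s).quad j (s.init.Λ (j + 1)) ω = (θ.zhAt p s).quad j (s.init.Λ (j + 1)) ω')
    (hpre : ∀ j, j < k → (θ.zhAt p s).ζ0 j = (θ.zhAt p s.init).ζ0 j ∧ (θ.zhAt p s).quad j = (θ.zhAt p s.init).quad j)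
    (t : Sect2.TermValues (F.P p.K) (MatA N) (FluctV N) θ.τ9.M) (E₀ : ℝ)
    (hB : ∀ (S : ℕ → Set (Site (F.P p.K) 0)) (j : ℕ), 1 ≤ j → j ≤ k → ∀ (X : (Sect2.domSys (F.P p.K) θ.τ9.M j).Dom) (u : Sect2.CPair (F.P p.K) (MatA N))
      (a a' : Tk.MSFluct (F.P p.K) (FluctV N)), (∀ i, i ≤ k → a i = a' i) → t.B j X u (S, a) = t.B j X u (S, a'))
    (hid : slotsOfRecord F N θ.ν θ.τ9 (EOfRecord₁₃ F N θ.toStage13Params) (wOfRecord₉ F N θ.toStage9Params) θ.ppSel p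
        (gOfRecord₁₃ F N θ.toStage13Params p) k s.init = 0 ∨
      ∀ᵐ U₀ ∂fieldMeasure (F.P p.K) k (SU N),
        chiSeqOfRecord F N θ.ν θ.τ9.M (gOfRecord₁₃ F N θ.toStage13Params p) p.K k s.init U₀ ≠ 0 →
          slotsOfRecord F N θ.ν θ.τ9 (EOfRecord₁₃ F N θ.toStage13Params) (wOfRecord₉ F N θ.toStage9Params) θ.ppSel p
              (gOfRecord₁₃ F N θ.toStage13Params p) k s.init U₀ =
            sect2Slot F N (FluctV N) p.K (settingOfRecord₁₃ F N θ.toStage13Params p) (θ.rzAt p s.init) (WtOfRecord₁₃H F N θ p s.init) s.init t E₀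
              (UbgOfRecord₁₃CoP F N θ.toStage13Params p k s.init) U₀)
    (hZ : ∀ (V' : GaugeField (F.P p.K) (k + 1) (SU N)) (U₀ : GaugeField (F.P p.K) k (SU N)),
      (θ.zhAt p s).ζ0 k Set.univ (pairCfgAt (V := FluctV N) k V' U₀) =
        chiSeqOfRecord F N θ.ν θ.τ9.M (gOfRecord₁₃ F N θ.toStage13Params p) p.K k s.init U₀ *
          wOfRecord₉ F N θ.toStage9Params p (gOfRecord₁₃ F N θ.toStage13Params p) k s U₀ ((avOfRecord F N p.K k).avg U₀))
    (hq : ∀ (V' : GaugeField (F.P p.K) (k + 1) (SU N)) (U₀ : GaugeField (F.P p.K) k (SU N)), (θ.zhAt p s).quad k ∅ (pairCfgAt (V := FluctV N) k V' U₀) = 0)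
    {C : ℝ}
    (hm : ∀ S ∈ admSOfRecord F θ.ν θ.τ9.M (gOfRecord₁₃ F N θ.toStage13Params p) p.K k s.init,
      Measurable (Function.uncurry (noExpIntegrandAt F N (FluctV N) p.K k (WtOfRecord₁₃H F N θ p s)
        (tkBranchOfRecord F N (FluctV N) θ.ν θ.τ9.M _ p.K (WtOfRecord₁₃H F N θ p s) s.init S k
          (fun ω => sect2Operand F N (FluctV N) p.K (settingOfRecord₁₃ F N θ.toStage13Params p) (θ.rzAt p s) s t E₀
            (UbgOfRecord₁₃CoP F N θ.toStage13Params p (k + 1) s) (S, fun j => (ω j).2) (fun j => (ω j).1))))))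
    (hC : ∀ S ∈ admSOfRecord F θ.ν θ.τ9.M (gOfRecord₁₃ F N θ.toStage13Params p) p.K k s.init, ∀ V' U₀,
      |noExpIntegrandAt F N (FluctV N) p.K k (WtOfRecord₁₃H F N θ p s)
        (tkBranchOfRecord F N (FluctV N) θ.ν θ.τ9.M _ p.K (WtOfRecord₁₃H F N θ p s) s.init S k
          (fun ω => sect2Operand F N (FluctV N) p.K (settingOfRecord₁₃ F N θ.toStage13Params p) (θ.rzAt p s) s t E₀
            (UbgOfRecord₁₃CoP F N θ.toStage13Params p (k + 1) s) (S, fun j => (ω j).2) (fun j => (ω j).1)))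
        V' U₀| ≤ C) :
    slotsOfRecord F N θ.ν θ.τ9 (EOfRecord₁₃ F N θ.toStage13Params) (wOfRecord₉ F N θ.toStage9Params) θ.ppSel p
        (gOfRecord₁₃ F N θ.toStage13Params p) (k + 1) s = 0 ∨
      ∀ᵐ V' ∂fieldMeasure (F.P p.K) (k + 1) (SU N),
        chiSeqOfRecord F N θ.ν θ.τ9.M (gOfRecord₁₃ F N θ.toStage13Params p) p.K (k + 1) s V' ≠ 0 →
          slotsOfRecord F N θ.ν θ.τ9 (EOfRecord₁₃ F N θ.toStage13Params) (wOfRecord₉ F N θ.toStage9Params) θ.ppSel p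
              (gOfRecord₁₃ F N θ.toStage13Params p) (k + 1) s V' =
            sect2Slot F N (FluctV N) p.K (settingOfRecord₁₃ F N θ.toStage13Params p) (θ.rzAt p s) (WtOfRecord₁₃H F N θ p s) s t E₀
              (UbgOfRecord₁₃CoP F N θ.toStage13Params p (k + 1) s) V' :=
  slotClauseΦ_succ_of_slotTClauseΦ_of_liveSel_of_rstep F N θ.toStage13Params p (fun q j _ hj => h.rstep q j hj) hsel k hk s _ fun _ =>
    clause_succ_CoPH_of_Omega_empty_of_pinChi_of_BLocal_of_clause θ p h hk hM s hΩ hqloc hpre t E₀ hB hid hZ hq hm hC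

end Generic

/-! ## §2. AT EVERY HISTORY-INDEXED EXTENSION OF THE WITNESS OF RECORD — row `rstep`, the selector clause and `M = 1` discharged; dag-n11-d's 𝐓-side data displayed -/

section OfRecord

variable (F N)
variable (Zr : (q : B12.RunParams) → TkResidualW F N (FluctV N) q.K)
  (Zh : (q : B12.RunParams) → ℕ → (ℕ → Set (Site (F.P q.K) 0)) → (ℕ → Set (Site (F.P q.K) 0)) → TkResidualW F N (FluctV N) q.K)
  (Phih : (q : B12.RunParams) → ℕ → (ℕ → Set (Site (F.P q.K) 0)) → (ℕ → Set (Site (F.P q.K) 0)) → (ℕ → Plaq (F.P q.K) 0 → ℝ)) (p : B12.RunParams)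

/-- **★★ THE NO-EXPANSION STEP AFTER ANY HISTORY, READ THROUGH 𝐑, AT EVERY HISTORY-INDEXED EXTENSION OF THE WITNESS OF RECORD** `(⟨⟨theta13LiveOfRecord F N, Zr⟩, Zh, Phih⟩ :
Stage13HParams F N)` (`Zr`, `Zh`, `Phih` free): for `k < K`, a new sequence `s′` of length `k+1` with `Ω_{k+1}(s′) = ∅` after ANY history, a witness `(t, E₀)` carrying the
level-`k` clause `hid` at `init s′`, and dag-n11-d's displayed data on the slot value `Zh p (k+1) (Ω s′) (Λ s′)` (`hloc`, `hqloc`, (P) `hpre` against `Zh p k (Ω init s′) (Λ init s′)`,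
(V) `hZ` + `hq`), `hA`, `hm` ∕ `hC`: the post-𝐑 slot of `ρ_{k+1}` at `s′` is absent or equals the extension's `𝐓_{k+1}(s′) exp A_{k+1}(s′)` at `(t, E₀)` a.e. on `supp χ_{k+1}(s′)`.
Row `rstep` and the selector clause are K0a ∕ K0b ∕ def-R theorems at the witness of record (`slotClauseΦ_succ_of_slotTClauseΦ_theta13LiveOfRecord`), `M = 1` by the family's
numerals; the extension's `.toStage13Params` is `theta13LiveOfRecord F N` and its `zhAt p s′` is `Zh p (k+1) (Ω s′) (Λ s′)`, both by `rfl`. [cite: Balaban1988Convergent, Thm 1 p.262, Theorem p.245, (3.24)–(3.25) p.270, (1.11) p.248, (3.16)–(3.22) pp.268–269, (2.20)–(2.25) pp.258–259; Balaban1989LargeFieldI, (0.2)–(0.4) p.176, p.177 (i)–(ii)] -/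
theorem slotClause_succ_theta13LiveOfRecordH_of_Omega_empty_of_pinChi_of_clause {k : ℕ} (hk : k < p.K)
    (s : SeqOfRecord F (theta13LiveOfRecord F N).ν (theta13LiveOfRecord F N).τ9.M (gOfRecord₁₃ F N (theta13LiveOfRecord F N) p) p.K (k + 1)) (hΩ : s.Ω (k + 1) = ∅)
    (hloc : (Zh p (k + 1) s.Ω s.Λ).LocalLaws)
    (hqloc : ∀ j, j < k → ∀ ω ω' : MultiCfg (F.P p.K) (SU N) (FluctV N), (∀ i, i ≤ k → ω i = ω' i) →
      (Zh p (k + 1) s.Ω s.Λ).quad j (s.init.Λ (j + 1)) ω = (Zh p (k + 1) s.Ω s.Λ).quad j (s.init.Λ (j + 1)) ω')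
    (hpre : ∀ j, j < k → (Zh p (k + 1) s.Ω s.Λ).ζ0 j = (Zh p k s.init.Ω s.init.Λ).ζ0 j ∧ (Zh p (k + 1) s.Ω s.Λ).quad j = (Zh p k s.init.Ω s.init.Λ).quad j)
    (t : Sect2.TermValues (F.P p.K) (MatA N) (FluctV N) (theta13LiveOfRecord F N).τ9.M) (E₀ : ℝ)
    (hA : ∀ (S : ℕ → Set (Site (F.P p.K) 0)) (a a' : Tk.MSFluct (F.P p.K) (FluctV N)) (Uf : GaugeField (F.P p.K) 0 (SU N)), (∀ i, i ≤ k → a i = a' i) →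
      (sect2ActionDataOfRecord F N (FluctV N) p.K (settingOfRecord₁₃ F N (theta13LiveOfRecord F N) p)
          ((⟨⟨theta13LiveOfRecord F N, Zr⟩, Zh, Phih⟩ : Stage13HParams F N).rzAt p s.init) s.init t (S, a) E₀).action23 k Uf =
        (sect2ActionDataOfRecord F N (FluctV N) p.K (settingOfRecord₁₃ F N (theta13LiveOfRecord F N) p)
          ((⟨⟨theta13LiveOfRecord F N, Zr⟩, Zh, Phih⟩ : Stage13HParams F N).rzAt p s.init) s.init t (S, a') E₀).action23 k Uf)
    (hid : slotsOfRecord F N (theta13LiveOfRecord F N).ν (theta13LiveOfRecord F N).τ9 (EOfRecord₁₃ F N (theta13LiveOfRecord F N))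
        (wOfRecord₉ F N (theta13LiveOfRecord F N).toStage9Params) (theta13LiveOfRecord F N).ppSel p (gOfRecord₁₃ F N (theta13LiveOfRecord F N) p) k s.init = 0 ∨
      ∀ᵐ U₀ ∂fieldMeasure (F.P p.K) k (SU N),
        chiSeqOfRecord F N (theta13LiveOfRecord F N).ν (theta13LiveOfRecord F N).τ9.M (gOfRecord₁₃ F N (theta13LiveOfRecord F N) p) p.K k s.init U₀ ≠ 0 →
          slotsOfRecord F N (theta13LiveOfRecord F N).ν (theta13LiveOfRecord F N).τ9 (EOfRecord₁₃ F N (theta13LiveOfRecord F N))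
              (wOfRecord₉ F N (theta13LiveOfRecord F N).toStage9Params) (theta13LiveOfRecord F N).ppSel p (gOfRecord₁₃ F N (theta13LiveOfRecord F N) p) k s.init U₀ =
            sect2Slot F N (FluctV N) p.K (settingOfRecord₁₃ F N (theta13LiveOfRecord F N) p)
              ((⟨⟨theta13LiveOfRecord F N, Zr⟩, Zh, Phih⟩ : Stage13HParams F N).rzAt p s.init)
              (WtOfRecord₁₃H F N (⟨⟨theta13LiveOfRecord F N, Zr⟩, Zh, Phih⟩ : Stage13HParams F N) p s.init) s.init t E₀
              (UbgOfRecord₁₃CoP F N (theta13LiveOfRecord F N) p k s.init) U₀)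
    (hZ : ∀ (V' : GaugeField (F.P p.K) (k + 1) (SU N)) (U₀ : GaugeField (F.P p.K) k (SU N)),
      (Zh p (k + 1) s.Ω s.Λ).ζ0 k Set.univ (pairCfgAt (V := FluctV N) k V' U₀) =
        chiSeqOfRecord F N (theta13LiveOfRecord F N).ν (theta13LiveOfRecord F N).τ9.M (gOfRecord₁₃ F N (theta13LiveOfRecord F N) p) p.K k s.init U₀ *
          wOfRecord₉ F N (theta13LiveOfRecord F N).toStage9Params p (gOfRecord₁₃ F N (theta13LiveOfRecord F N) p) k s U₀ ((avOfRecord F N p.K k).avg U₀))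
    (hq : ∀ (V' : GaugeField (F.P p.K) (k + 1) (SU N)) (U₀ : GaugeField (F.P p.K) k (SU N)),
      (Zh p (k + 1) s.Ω s.Λ).quad k ∅ (pairCfgAt (V := FluctV N) k V' U₀) = 0)
    {C : ℝ}
    (hm : ∀ S ∈ admSOfRecord F (theta13LiveOfRecord F N).ν (theta13LiveOfRecord F N).τ9.M (gOfRecord₁₃ F N (theta13LiveOfRecord F N) p) p.K k s.init,
      Measurable (Function.uncurry (noExpIntegrandAt F N (FluctV N) p.K k
        (WtOfRecord₁₃H F N (⟨⟨theta13LiveOfRecord F N, Zr⟩, Zh, Phih⟩ : Stage13HParams F N) p s)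
        (tkBranchOfRecord F N (FluctV N) (theta13LiveOfRecord F N).ν (theta13LiveOfRecord F N).τ9.M _ p.K
          (WtOfRecord₁₃H F N (⟨⟨theta13LiveOfRecord F N, Zr⟩, Zh, Phih⟩ : Stage13HParams F N) p s) s.init S k
          (fun ω => sect2Operand F N (FluctV N) p.K (settingOfRecord₁₃ F N (theta13LiveOfRecord F N) p)
            ((⟨⟨theta13LiveOfRecord F N, Zr⟩, Zh, Phih⟩ : Stage13HParams F N).rzAt p s) s t E₀
            (UbgOfRecord₁₃CoP F N (theta13LiveOfRecord F N) p (k + 1) s) (S, fun j => (ω j).2) (fun j => (ω j).1))))))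
    (hC : ∀ S ∈ admSOfRecord F (theta13LiveOfRecord F N).ν (theta13LiveOfRecord F N).τ9.M (gOfRecord₁₃ F N (theta13LiveOfRecord F N) p) p.K k s.init, ∀ V' U₀,
      |noExpIntegrandAt F N (FluctV N) p.K k
        (WtOfRecord₁₃H F N (⟨⟨theta13LiveOfRecord F N, Zr⟩, Zh, Phih⟩ : Stage13HParams F N) p s)
        (tkBranchOfRecord F N (FluctV N) (theta13LiveOfRecord F N).ν (theta13LiveOfRecord F N).τ9.M _ p.K
          (WtOfRecord₁₃H F N (⟨⟨theta13LiveOfRecord F N, Zr⟩, Zh, Phih⟩ : Stage13HParams F N) p s) s.init S k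
          (fun ω => sect2Operand F N (FluctV N) p.K (settingOfRecord₁₃ F N (theta13LiveOfRecord F N) p)
            ((⟨⟨theta13LiveOfRecord F N, Zr⟩, Zh, Phih⟩ : Stage13HParams F N).rzAt p s) s t E₀
            (UbgOfRecord₁₃CoP F N (theta13LiveOfRecord F N) p (k + 1) s) (S, fun j => (ω j).2) (fun j => (ω j).1)))
        V' U₀| ≤ C) :
    slotsOfRecord F N (theta13LiveOfRecord F N).ν (theta13LiveOfRecord F N).τ9 (EOfRecord₁₃ F N (theta13LiveOfRecord F N))
        (wOfRecord₉ F N (theta13LiveOfRecord F N).toStage9Params) (theta13LiveOfRecord F N).ppSel p (gOfRecord₁₃ F N (theta13LiveOfRecord F N) p) (k + 1) s = 0 ∨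
      ∀ᵐ V' ∂fieldMeasure (F.P p.K) (k + 1) (SU N),
        chiSeqOfRecord F N (theta13LiveOfRecord F N).ν (theta13LiveOfRecord F N).τ9.M (gOfRecord₁₃ F N (theta13LiveOfRecord F N) p) p.K (k + 1) s V' ≠ 0 →
          slotsOfRecord F N (theta13LiveOfRecord F N).ν (theta13LiveOfRecord F N).τ9 (EOfRecord₁₃ F N (theta13LiveOfRecord F N))
              (wOfRecord₉ F N (theta13LiveOfRecord F N).toStage9Params) (theta13LiveOfRecord F N).ppSel p (gOfRecord₁₃ F N (theta13LiveOfRecord F N) p) (k + 1) s V' =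
            sect2Slot F N (FluctV N) p.K (settingOfRecord₁₃ F N (theta13LiveOfRecord F N) p)
              ((⟨⟨theta13LiveOfRecord F N, Zr⟩, Zh, Phih⟩ : Stage13HParams F N).rzAt p s)
              (WtOfRecord₁₃H F N (⟨⟨theta13LiveOfRecord F N, Zr⟩, Zh, Phih⟩ : Stage13HParams F N) p s) s t E₀
              (UbgOfRecord₁₃CoP F N (theta13LiveOfRecord F N) p (k + 1) s) V' := by
  -- `M = 1` by the family's numerals
  have hM : 1 ≤ (theta13LiveOfRecord F N).τ9.M := le_of_eq rfl
  -- the 𝐓-side clause at the extension (its `.toStage13Params` is `θ_rec`, its `zhAt p s′` is `Zh p (k+1) (Ω s′) (Λ s′)`, both by `rfl`), stated EXPLICITLY there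
  have hT := clause_succ_CoPH_of_Omega_empty_of_pinChi_of_clause (⟨⟨theta13LiveOfRecord F N, Zr⟩, Zh, Phih⟩ : Stage13HParams F N) p hk hM s hΩ
    hloc hqloc hpre t E₀ hA hid hZ hq hm hC
  -- the 𝐑-side at the witness of record: zero hypotheses beyond `k < K`
  exact slotClauseΦ_succ_of_slotTClauseΦ_theta13LiveOfRecord F N p k hk s _ fun _ => hT

end OfRecord

end Summit.QuantumFields.YangMills.Theorems.BalabanUVNodesN11NoExpansionGeneralStepPostRCoPH

end
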